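import Summits.CriticalPhenomena.Ising3DConformalLimit.Theorems.PerfectScreeningGaussianLimitNotScreenedDefs
import Literature.Probability.LatticeModels.SourcedDoubleCurrentsOneArmMoments
import HarnessLib

/-!
# Crux `GaussianLimitNotScreened` (stmt-CriticalPhenomena-13886), line `karamata-amplitude-blind-merging`:
# registered stub `stub_clusterMomentsBox` (one-arm cluster moments in the free box — Paley–Zygmund ∧ Markov)

THEOREM-ONLY file (no definitions). In the free box `Λ_L ⊂ ℤ³` at `β_c(3)`, for `a, b ∈ Λ_L`, `A ⊆ Λ_L`,
an exponent `s`, a mass level `0 ≤ m ≤ M₁` and an energy level `t > 0`, the box law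
`P^{{a}∆{b},∅}_{Λ_L,β_c}` of the trace of a sourced double current (`sourcedDoubleCurrentLaw`) gives the
event "`#(C(a) ∩ A) ≥ m` and `I_s(C(a) ∩ A) ≤ t`" probability at least `(M₁ − m)²/M₂ − E_s/t`
(`oneArmMoment₁/₂`, `energyMoment`, `traceCluster`, `rieszEnergy` of the line's Defs module): the instance
`d = 3`, `β = β_c(3)`, `G = boxG L`, `φ(u,v) = ‖u − v‖^{−s}` of the tree theorem
`sourcedDoubleCurrentLaw_real_oneArm_ge` (M. Aizenman, H. Duminil-Copin, Ann. of Math. **194** (2021) =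
arXiv:1912.07973, App. A Prop. A.3 with the second-moment method of §4.2, Lemma 4.4: `E X = M₁` exactly by
switching, `E X² ≤ M₂`, `E I_s ≤ E_s`, Paley–Zygmund `(E X − m)² ≤ P[X ≥ m]·E X²` for `m ≥ 0`, Markov,
union bound). Everything is proved; no definition and no named fact is introduced.
Reference: ADC21 §3.1–3.2, §4.2 (proof of Lemma 4.4), App. A.2 (Prop. A.3) [AizenmanDuminilCopinAnnals2021].
-/

noncomputable section

open Filter Topology Set Function MeasureTheory Finset
open Literature.Probability.LatticeModels Literature.Probability.Percolation
open Summit.CriticalPhenomena.Ising3DConformalLimit.Cruxes.IsingEuclidUpgradeR4NonGaussian.FreeCovarianceDeltaDichotomy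
  (lat boxG threePointRatio twoStep)
open scoped symmDiff ENNReal

namespace Summit.CriticalPhenomena.Ising3DConformalLimit.Cruxes.GaussianLimitNotScreened.KaramataAmplitudeBlindMerging

/-- **Registered stub `stub_clusterMomentsBox`** (line `karamata-amplitude-blind-merging` of crux
stmt-CriticalPhenomena-13886; ONE-ARM CLUSTER MOMENTS IN THE BOX, Paley–Zygmund ∧ Markov). For
`a, b ∈ Λ_L`, `A ⊆ Λ_L`, an exponent `s`, a mass level `0 ≤ m ≤ M₁` and an energy level `t > 0`: the box
law `P^{{a}∆{b},∅}_{Λ_L,β_c}` of the trace gives the event "the double cluster of `a` has at least `m`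
sites in `A` and their Riesz `s`-energy is at most `t`" probability at least `(M₁ − m)²/M₂ − E_s/t`:
`X := #(C(a) ∩ A)` has `E X = M₁` exactly (switching), `E X² ≤ M₂` and `E I_s(C(a) ∩ A) ≤ E_s`
(ADC21 Prop. A.3), `(E X − m)² ≤ E[X 𝟙{X ≥ m}]² ≤ P[X ≥ m] E X²` (this step needs `m ≥ 0`), Markov
`P[I_s > t] ≤ E_s/t`, union bound; the degenerate case `G_L(a,b) = 0` holds by `x/0 = 0`. The instance
`d = 3`, `β = β_c`, `G = boxG L`, `φ = ‖· − ·‖^{−s}` of the tree's `sourcedDoubleCurrentLaw_real_oneArm_ge`.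
[cite: AizenmanDuminilCopinAnnals2021, §4.2 Lemma 4.4 and App. A Prop. A.3] -/
theorem stub_clusterMomentsBox :
    ∀ (L : ℕ) (a b : Site 3), a ∈ box 3 L → b ∈ box 3 L → ∀ A : Finset (Site 3), A ⊆ box 3 L →
      ∀ (s m t : ℝ), 0 < t → 0 ≤ m → m ≤ oneArmMoment₁ L a b A →
        (oneArmMoment₁ L a b A - m) ^ 2 / oneArmMoment₂ L a b A - energyMoment L a b s A / t ≤
          (sourcedDoubleCurrentLaw 3 L (criticalBeta 3) ({a} ∆ {b}) ∅).real
            {ω | m ≤ ((traceCluster L ω a ∩ A).card : ℝ) ∧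
              rieszEnergy s (traceCluster L ω a ∩ A) ≤ t} := by
  intro L a b ha hb A hA s m t ht hm0 hm
  exact sourcedDoubleCurrentLaw_real_oneArm_ge L (criticalBeta_nonneg 3) (boxG L) (fun x y _ _ => rfl)
    ha hb hA (fun u v => (‖u - v‖ : ℝ) ^ (-s)) (fun u v => Real.rpow_nonneg (norm_nonneg _) _) ht hm0 hm

end Summit.CriticalPhenomena.Ising3DConformalLimit.Cruxes.GaussianLimitNotScreened.KaramataAmplitudeBlindMerging

end
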